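import Summits.CriticalPhenomena.PercolationContinuityZ3.Theorems.PercNearOneGluingNoHeavyLowerTailSahiRootSideCongr
import Summits.CriticalPhenomena.PercolationContinuityZ3.Theorems.PercNearOneGluingNoHeavyLowerTailSahiPrincipalCutVertex
import Summits.CriticalPhenomena.PercolationContinuityZ3.Theorems.PercNearOneGluingNoHeavyLowerTailSahiPrincipalCycleBlocks
import HarnessLib

/-!
# Root-side reduction, III: every root side is a claw; minimal counterexamples have no targetless root side

Support file for the Sahi programme (`--supports stmt-CriticalPhenomena-4575`, prover prim-sahi-p2 gen 12).
No definitions, no named facts, no sorries; standard axioms.  Memo `…/prim-sahi-p2/PROOF-E3.md` §23.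

Setting of Parts I–II (`…SahiRootSideSep`, `…SahiRootSideCongr`): a root side `R ∋ s` separated from the rest of the graph by
two vertices `u ≠ v ∉ R` (no pair of positive weight from `R` to the outside of `R ∪ {u,v}`).  By Part II the root side is felt
by the principal cluster events `{C_s ⊇ U}`, `U ∩ R = ∅`, only through the three numbers
`a = P(s ↔_R u, s ↮_R v)`, `b = P(s ↮_R u, s ↔_R v)`, `c = P(s ↔_R u, s ↔_R v)`.

By Part II (`real_rootSide_cells_claw`) a CLAW root side — the root `s` joined to a hub `h ∈ R` with probability `ρ`, the
hub joined to `u` and `v` with probabilities `α`, `β`, every other pair meeting `R` of weight `0` — has the three numbers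
`ρα(1−β)`, `ρβ(1−α)`, `ραβ`.
* `exists_claw_params`: every `(a, b, c)` with `a, b ≤ 1` and `(a+c)(b+c) ≤ c` (HARRIS' inequality for the increasing events
  `{s ↔_R u}`, `{s ↔_R v}`) is of this form, with the RATIONAL choice `α = c/(b+c)`, `β = c/(a+c)`, `ρ = (a+c)(b+c)/c`
  (degenerate cases `c = 0` aside) — no square roots, unlike the triangle realisation of memo §22f.
* `exists_clawReduce`: hence for every root side with at least two vertices `s ≠ h ∈ R` there is a claw weight `w'` (equal to
  `w` off the pairs meeting `R`; supported on `s(s,h), s(h,u), s(h,v)` among them) with the same Sahi functional `E_n` for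
  every family of principal cluster events with targets outside `R`, at every order `n`.
* `sahiE_principal_of_rootSide`, `incStar_of_rootSide`: since the root of a claw is a pendant vertex, the cut-vertex theorems
  (`SahiPrincipalCutVertex.sahiE_principal_of_cutVertex_univ`, `IncStarCutVertex.incStar_of_cutVertex`, with the edge block
  `IncStarCycle.sahiE_principal_edge_nonneg`) reduce positivity for `(w, s)` to positivity for the claw weights rooted at the
  hub `h` inside `V ∖ {s}` — a graph with fewer vertices in which the root has (at most) the two neighbours `u, v`.
**Consequence** (memo §23): a minimal counterexample to Sahi positivity of principal cluster events at any order — in particular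
to the increasing-star inequality `E₃({s↔a},{s↔b},{s↔c}) ≥ 0` — has no two-separation `{u,v}` whose root side is free of
targets, unless that side is the root alone; together with the blob reduction (`…SahiBlobReduction`, targetless rootless sides
are single pairs) every genuine two-separator of a minimal counterexample has a target strictly inside each side, or cuts off
exactly a root of degree two.
-/

noncomputable section

namespace Summit.CriticalPhenomena.PercolationContinuityZ3.Theorems

namespace SahiRootSide

open Finset MeasureTheory Literature.Combinatorics.Sahi2008 Literature.Probability.Percolation
  Literature.Probability.LatticeModels
open Literature.Probability.Percolation.DecisionTree (ind ind_of_mem ind_of_not_mem ind_nonneg)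
open scoped Classical

variable {V : Type*} [Fintype V]

omit [Fintype V] in
/-- **Claw parameters.**  Every triple `a, b, c ≥ 0` with `a, b ≤ 1` and `(a + c)(b + c) ≤ c` — Harris' inequality
`P(A)P(B) ≤ P(A ∩ B)` for `a = P(A ∖ B)`, `b = P(B ∖ A)`, `c = P(A ∩ B)` — is `(ρα(1−β), ρβ(1−α), ραβ)` for some
`ρ, α, β ∈ [0,1]`; for `c > 0` one may take `α = c/(b+c)`, `β = c/(a+c)`, `ρ = (a+c)(b+c)/c`. [this work] -/
theorem exists_claw_params {a b c : ℝ} (ha : 0 ≤ a) (hb : 0 ≤ b) (hc : 0 ≤ c) (ha1 : a ≤ 1) (hb1 : b ≤ 1)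
    (hH : (a + c) * (b + c) ≤ c) :
    ∃ ρ α β : unitInterval, (ρ : ℝ) * α * (1 - β) = a ∧ (ρ : ℝ) * β * (1 - α) = b ∧ (ρ : ℝ) * α * β = c := by
  by_cases hc0 : c = 0
  · subst hc0
    have hab : a * b = 0 := le_antisymm (by nlinarith) (mul_nonneg ha hb)
    rcases mul_eq_zero.1 hab with rfl | rfl
    · exact ⟨⟨b, hb, hb1⟩, 0, 1, by simp, by simp, by simp⟩
    · exact ⟨⟨a, ha, ha1⟩, 1, 0, by simp, by simp, by simp⟩
  · have hcpos : 0 < c := lt_of_le_of_ne hc (Ne.symm hc0)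
    have hbc : 0 < b + c := by linarith
    have hac : 0 < a + c := by linarith
    have hρ1 : (a + c) * (b + c) / c ≤ 1 := (div_le_one hcpos).2 hH
    have hρ0 : 0 ≤ (a + c) * (b + c) / c := div_nonneg (mul_nonneg hac.le hbc.le) hc
    refine ⟨⟨(a + c) * (b + c) / c, hρ0, hρ1⟩, ⟨c / (b + c), div_nonneg hc hbc.le, (div_le_one hbc).2 (by linarith)⟩,
      ⟨c / (a + c), div_nonneg hc hac.le, (div_le_one hac).2 (by linarith)⟩, ?_, ?_, ?_⟩
    · simp only []
      field_simp
      ring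
    · simp only []
      field_simp
      ring
    · simp only []
      field_simp

/-- **Every root side is a claw (existence of the reduced weight).**  Let `{u, v}` (`u ≠ v ∉ R`) separate the root side
`R ∋ s` from the rest, and let `h ∈ R`, `h ≠ s`.  There is a weight `w'`, equal to `w` on the pairs not meeting `R` and
vanishing on the pairs meeting `R` other than `s(s,h), s(h,u), s(h,v)`, under which every family of principal cluster events
`{C_s ⊇ T_i}` with targets outside `R` has the same Sahi functional `E_n` as under `w`, for every `n`. [this work] -/
theorem exists_clawReduce (w : Sym2 V → unitInterval) (R : Finset V) {s h u v : V} (hs : s ∈ R) (hh : h ∈ R)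
    (hsh : s ≠ h) (hu : u ∉ R) (hv : v ∉ R) (huv : u ≠ v)
    (hw : ∀ x ∈ R, ∀ z, z ∉ R → z ≠ u → z ≠ v → w s(x, z) = 0) :
    ∃ w' : Sym2 V → unitInterval,
      (∀ e : Sym2 V, (∀ y ∈ R, y ∉ e) → w' e = w e) ∧
      (∀ e : Sym2 V, (∃ y ∈ R, y ∈ e) → e ≠ s(s, h) → e ≠ s(h, u) → e ≠ s(h, v) → w' e = 0) ∧
      ∀ (n : ℕ) (T : Fin n → Finset V), (∀ i, ∀ t ∈ T i, t ∉ R) →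
        sahiE (bernoulliWeight w) n (fun i => ind (⋂ t ∈ T i, (openConn s t : Set (BondConfig V)))) =
          sahiE (bernoulliWeight w') n (fun i => ind (⋂ t ∈ T i, (openConn s t : Set (BondConfig V)))) := by
  set F : Set (Sym2 V) := {e : Sym2 V | ∃ y ∈ (R : Set V), y ∈ e} with hF
  set Au : Set (BondConfig V) := {ω | ω ∩ F ∈ (openConn s u : Set (BondConfig V))} with hAu
  set Av : Set (BondConfig V) := {ω | ω ∩ F ∈ (openConn s v : Set (BondConfig V))} with hAv
  -- the three numbers of `w` and Harris' inequality
  have hm : ∀ X : Set (BondConfig V), MeasurableSet X := fun _ => MeasurableSet.of_discrete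
  have hupA : ∀ x : V, IsUpperSet {ω : BondConfig V | ω ∩ F ∈ (openConn s x : Set (BondConfig V))} := by
    intro x ω ω' hle hω
    exact isUpperSet_openConn s x (Set.inter_subset_inter_left F hle) hω
  have hHarris : (prodBernoulli w).real Au * (prodBernoulli w).real Av ≤ (prodBernoulli w).real (Au ∩ Av) :=
    prodBernoulli_harris w (hupA u) (hupA v) (hm _) (hm _)
  have hAu_split : (prodBernoulli w).real (Au ∩ Av) + (prodBernoulli w).real (Au \ Av) = (prodBernoulli w).real Au :=
    measureReal_inter_add_sdiff (hm Av)
  have hAv_split : (prodBernoulli w).real (Av ∩ Au) + (prodBernoulli w).real (Av \ Au) = (prodBernoulli w).real Av :=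
    measureReal_inter_add_sdiff (hm Au)
  have hcomm : Av ∩ Au = Au ∩ Av := Set.inter_comm _ _
  rw [hcomm] at hAv_split
  obtain ⟨ρ, α, β, h1, h2, h3⟩ := exists_claw_params (a := (prodBernoulli w).real (Au \ Av))
    (b := (prodBernoulli w).real (Av \ Au)) (c := (prodBernoulli w).real (Au ∩ Av)) measureReal_nonneg measureReal_nonneg
    measureReal_nonneg measureReal_le_one measureReal_le_one (by
      have e1 : (prodBernoulli w).real (Au \ Av) + (prodBernoulli w).real (Au ∩ Av) = (prodBernoulli w).real Au := by
        linarith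
      have e2 : (prodBernoulli w).real (Av \ Au) + (prodBernoulli w).real (Au ∩ Av) = (prodBernoulli w).real Av := by
        linarith
      rw [e1, e2]; exact hHarris)
  -- the claw weight
  obtain ⟨w', hw'def⟩ : ∃ w' : Sym2 V → unitInterval, ∀ e, w' e =
      if ∃ y ∈ R, y ∈ e then (if e = s(s, h) then ρ else if e = s(h, u) then α else if e = s(h, v) then β else 0)
      else w e := ⟨_, fun e => rfl⟩
  have hsu : s ≠ u := fun h' => hu (h' ▸ hs)
  have hsv : s ≠ v := fun h' => hv (h' ▸ hs)
  have hhu : h ≠ u := fun h' => hu (h' ▸ hh)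
  have hhv : h ≠ v := fun h' => hv (h' ▸ hh)
  have d12 : s(h, u) ≠ s(s, h) := fun he => by
    rcases Sym2.eq_iff.1 he with ⟨h1, -⟩ | ⟨-, h1⟩; exacts [hsh h1.symm, hsu h1.symm]
  have d13 : s(h, v) ≠ s(s, h) := fun he => by
    rcases Sym2.eq_iff.1 he with ⟨h1, -⟩ | ⟨-, h1⟩; exacts [hsh h1.symm, hsv h1.symm]
  have d23 : s(h, v) ≠ s(h, u) := fun he => by
    rcases Sym2.eq_iff.1 he with ⟨-, h1⟩ | ⟨h1, -⟩; exacts [huv h1.symm, hhu h1]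
  have hoff : ∀ e : Sym2 V, (∀ y ∈ R, y ∉ e) → w' e = w e := fun e he => by
    rw [hw'def, if_neg (by push Not; exact he)]
  have hzero : ∀ e : Sym2 V, (∃ y ∈ R, y ∈ e) → e ≠ s(s, h) → e ≠ s(h, u) → e ≠ s(h, v) → w' e = 0 :=
    fun e he h1' h2' h3' => by rw [hw'def, if_pos he, if_neg h1', if_neg h2', if_neg h3']
  have hρ : w' s(s, h) = ρ := by rw [hw'def, if_pos ⟨s, hs, Sym2.mem_mk_left s h⟩, if_pos rfl]
  have hα : w' s(h, u) = α := by rw [hw'def, if_pos ⟨h, hh, Sym2.mem_mk_left h u⟩, if_neg d12, if_pos rfl]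
  have hβ : w' s(h, v) = β := by rw [hw'def, if_pos ⟨h, hh, Sym2.mem_mk_left h v⟩, if_neg d13, if_neg d23, if_pos rfl]
  have hw' : ∀ x ∈ R, ∀ z, z ∉ R → z ≠ u → z ≠ v → w' s(x, z) = 0 := by
    intro x hx z hz hzu hzv
    refine hzero _ ⟨x, hx, Sym2.mem_mk_left x z⟩ ?_ ?_ ?_
    · intro he
      rcases Sym2.eq_iff.1 he with ⟨-, rfl⟩ | ⟨-, rfl⟩; exacts [hz hh, hz hs]
    · intro he
      rcases Sym2.eq_iff.1 he with ⟨-, rfl⟩ | ⟨-, rfl⟩; exacts [hzu rfl, hz hh]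
    · intro he
      rcases Sym2.eq_iff.1 he with ⟨-, rfl⟩ | ⟨-, rfl⟩; exacts [hzv rfl, hz hh]
  obtain ⟨c1, c2, c3⟩ := real_rootSide_cells_claw w' R hs hh hsh hu hv huv hzero
  rw [hρ, hα, hβ] at c1 c2 c3
  -- identify the cell sets of the statements with `Au \\ Av`, `Av \\ Au`, `Au ∩ Av`
  have e1 : {ω : BondConfig V | ω ∩ F ∈ (openConn s u : Set (BondConfig V)) ∧
      ω ∩ F ∉ (openConn s v : Set (BondConfig V))} = Au \ Av := by ext ω; simp [hAu, hAv]
  have e2 : {ω : BondConfig V | ω ∩ F ∉ (openConn s u : Set (BondConfig V)) ∧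
      ω ∩ F ∈ (openConn s v : Set (BondConfig V))} = Av \ Au := by ext ω; simp [hAu, hAv, and_comm]
  have e3 : {ω : BondConfig V | ω ∩ F ∈ (openConn s u : Set (BondConfig V)) ∧
      ω ∩ F ∈ (openConn s v : Set (BondConfig V))} = Au ∩ Av := by ext ω; simp [hAu, hAv]
  refine ⟨w', hoff, hzero, fun n T hT => ?_⟩
  refine sahiE_principal_rootSide_congr w w' R hs hw hw' hoff ?_ ?_ ?_ n T hT
  · rw [c1, e1, h1]
  · rw [c2, e2, h2]
  · rw [c3, e3, h3]

/-- **The increasing star is claw-reducible**: with `w'` as in `exists_clawReduce`, `E₃({s↔a},{s↔b},{s↔c})` is the same under `w`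
and `w'` for all targets `a, b, c` outside the root side (the order-3, point-target instance, spelled out for the referee and the
census). [this work] -/
theorem sahiE3_incStar_clawReduce (w : Sym2 V → unitInterval) (R : Finset V) {s h u v : V} (hs : s ∈ R) (hh : h ∈ R)
    (hsh : s ≠ h) (hu : u ∉ R) (hv : v ∉ R) (huv : u ≠ v)
    (hw : ∀ x ∈ R, ∀ z, z ∉ R → z ≠ u → z ≠ v → w s(x, z) = 0) :
    ∃ w' : Sym2 V → unitInterval,
      (∀ e : Sym2 V, (∀ y ∈ R, y ∉ e) → w' e = w e) ∧
      (∀ e : Sym2 V, (∃ y ∈ R, y ∈ e) → e ≠ s(s, h) → e ≠ s(h, u) → e ≠ s(h, v) → w' e = 0) ∧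
      ∀ a b c : V, a ∉ R → b ∉ R → c ∉ R →
        sahiE3 (prodBernoulli w) (openConn s a) (openConn s b) (openConn s c) =
          sahiE3 (prodBernoulli w') (openConn s a) (openConn s b) (openConn s c) := by
  obtain ⟨w', hoff, hzero, hE⟩ := exists_clawReduce w R hs hh hsh hu hv huv hw
  refine ⟨w', hoff, hzero, fun a b c ha hb hc => ?_⟩
  have conv : ∀ W : Sym2 V → unitInterval, sahiE3 (prodBernoulli W) (openConn s a) (openConn s b) (openConn s c) =
      sahiE (bernoulliWeight W) 3 (fun i => ind (⋂ t ∈ (![{a}, {b}, {c}] : Fin 3 → Finset V) i,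
        (openConn s t : Set (BondConfig V)))) := by
    intro W
    have hf : (fun i : Fin 3 => ind (⋂ t ∈ (![{a}, {b}, {c}] : Fin 3 → Finset V) i,
        (openConn s t : Set (BondConfig V)))) = ![ind (openConn s a), ind (openConn s b), ind (openConn s c)] := by
      funext i; fin_cases i <;> simp
    rw [hf, sahiE_three_ind]
  rw [conv, conv, hE 3 _ (fun i => by fin_cases i <;> simpa)]

/-- **Root-side reduction at every order.**  If, for every claw weight `w'` as in `exists_clawReduce`, all principal cluster
families of the hub `h` inside `V ∖ {s}` are Sahi-positive at every order, then all principal cluster families of `(w, s)`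
with targets outside the root side `R` are Sahi-positive at every order.  (The root of the claw is pendant: cut-vertex theorem
`SahiPrincipalCutVertex.sahiE_principal_of_cutVertex_univ` with the edge block `IncStarCycle.sahiE_principal_edge_nonneg`.)
So a minimal counterexample has no targetless root side other than the root itself. [this work] -/
theorem sahiE_principal_of_rootSide (w : Sym2 V → unitInterval) (R : Finset V) {s h u v : V} (hs : s ∈ R) (hh : h ∈ R)
    (hsh : s ≠ h) (hu : u ∉ R) (hv : v ∉ R) (huv : u ≠ v)
    (hw : ∀ x ∈ R, ∀ z, z ∉ R → z ≠ u → z ≠ v → w s(x, z) = 0)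
    (H : ∀ w' : Sym2 V → unitInterval, (∀ e : Sym2 V, (∀ y ∈ R, y ∉ e) → w' e = w e) →
      (∀ e : Sym2 V, (∃ y ∈ R, y ∈ e) → e ≠ s(s, h) → e ≠ s(h, u) → e ≠ s(h, v) → w' e = 0) →
      ∀ (m : ℕ) (T : Fin m → Finset V), (∀ j, ∀ t ∈ T j, t ∈ {x : V | x ≠ s}) →
        0 ≤ sahiE (bernoulliWeight w') m
          (fun j => ind (⋂ t ∈ T j, (openConnIn {x : V | x ≠ s} h t : Set (BondConfig V)))))
    (n : ℕ) (T : Fin n → Finset V) (hT : ∀ i, ∀ t ∈ T i, t ∉ R) :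
    0 ≤ sahiE (bernoulliWeight w) n (fun i => ind (⋂ t ∈ T i, (openConn s t : Set (BondConfig V)))) := by
  obtain ⟨w', hoff, hzero, hE⟩ := exists_clawReduce w R hs hh hsh hu hv huv hw
  rw [hE n T hT]
  have hsu : s ≠ u := fun h' => hu (h' ▸ hs)
  have hsv : s ≠ v := fun h' => hv (h' ▸ hs)
  refine SahiPrincipalCutVertex.sahiE_principal_of_cutVertex_univ w' (V₁ := ({s, h} : Set V)) (V₂ := {x : V | x ≠ s})
    (a := h) (s := s) ?_ (by simp) (by simpa using hsh.symm) (by simp) ?_ ?_ ?_ ?_ T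
  · intro x hx hx'
    rcases hx with rfl | rfl
    · exact absurd rfl hx'
    · rfl
  · intro x
    by_cases hx : x = s
    · exact Or.inl (Or.inl hx)
    · exact Or.inr hx
  · intro x y hx hy hxh hyh
    rcases hx with rfl | rfl
    · refine hzero _ ⟨x, hs, Sym2.mem_mk_left x y⟩ ?_ ?_ ?_
      · intro he
        rcases Sym2.eq_iff.1 he with ⟨-, h1⟩ | ⟨h1, -⟩; exacts [hyh h1, hxh h1]
      · intro he
        rcases Sym2.eq_iff.1 he with ⟨h1, -⟩ | ⟨h1, -⟩; exacts [hxh h1, hsu h1]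
      · intro he
        rcases Sym2.eq_iff.1 he with ⟨h1, -⟩ | ⟨h1, -⟩; exacts [hxh h1, hsv h1]
    · exact absurd rfl hxh
  · exact fun m T' hT' => IncStarCycle.sahiE_principal_edge_nonneg w' s h m T' hT'
  · exact H w' hoff hzero

/-- **Root-side reduction for the increasing star.**  If, for every claw weight `w'` as in `exists_clawReduce`, the
increasing star holds for the hub `h` inside `V ∖ {s}`, then `E₃({s↔a},{s↔b},{s↔c}) ≥ 0` under `w` for all targets outside the
root side `R`.  Hence a minimal counterexample to the increasing-star inequality has no two-separation with a targetless root
side, except a root of degree two. [this work] -/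
theorem incStar_of_rootSide (w : Sym2 V → unitInterval) (R : Finset V) {s h u v : V} (hs : s ∈ R) (hh : h ∈ R)
    (hsh : s ≠ h) (hu : u ∉ R) (hv : v ∉ R) (huv : u ≠ v)
    (hw : ∀ x ∈ R, ∀ z, z ∉ R → z ≠ u → z ≠ v → w s(x, z) = 0)
    (H : ∀ w' : Sym2 V → unitInterval, (∀ e : Sym2 V, (∀ y ∈ R, y ∉ e) → w' e = w e) →
      (∀ e : Sym2 V, (∃ y ∈ R, y ∈ e) → e ≠ s(s, h) → e ≠ s(h, u) → e ≠ s(h, v) → w' e = 0) →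
      ∀ x y z : V, x ≠ s → y ≠ s → z ≠ s →
        0 ≤ sahiE3 (prodBernoulli w') (openConnIn {t : V | t ≠ s} h x) (openConnIn {t : V | t ≠ s} h y)
          (openConnIn {t : V | t ≠ s} h z))
    {a b c : V} (ha : a ∉ R) (hb : b ∉ R) (hc : c ∉ R) :
    0 ≤ sahiE3 (prodBernoulli w) (openConn s a) (openConn s b) (openConn s c) := by
  obtain ⟨w', hoff, hzero, hE⟩ := exists_clawReduce w R hs hh hsh hu hv huv hw
  -- `E₃` as the order-3 Sahi functional of the singleton-target family
  have conv : ∀ W : Sym2 V → unitInterval, sahiE3 (prodBernoulli W) (openConn s a) (openConn s b) (openConn s c) =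
      sahiE (bernoulliWeight W) 3 (fun i => ind (⋂ t ∈ (![{a}, {b}, {c}] : Fin 3 → Finset V) i,
        (openConn s t : Set (BondConfig V)))) := by
    intro W
    have hf : (fun i : Fin 3 => ind (⋂ t ∈ (![{a}, {b}, {c}] : Fin 3 → Finset V) i,
        (openConn s t : Set (BondConfig V)))) = ![ind (openConn s a), ind (openConn s b), ind (openConn s c)] := by
      funext i; fin_cases i <;> simp
    rw [hf, sahiE_three_ind]
  rw [conv, hE 3 _ (fun i => by fin_cases i <;> simpa), ← conv]
  have hsu : s ≠ u := fun h' => hu (h' ▸ hs)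
  have hsv : s ≠ v := fun h' => hv (h' ▸ hs)
  refine IncStarCutVertex.incStar_of_cutVertex w' (V₁ := ({s, h} : Set V)) (V₂ := {x : V | x ≠ s}) (a := h) (s := s)
    ?_ (by simp) (by simpa using hsh.symm) (by simp) ?_ ?_ ?_ ?_ a b c
  · intro x hx hx'
    rcases hx with rfl | rfl
    · exact absurd rfl hx'
    · rfl
  · intro x
    by_cases hx : x = s
    · exact Or.inl (Or.inl hx)
    · exact Or.inr hx
  · intro x y hx hy hxh hyh
    rcases hx with rfl | rfl
    · refine hzero _ ⟨x, hs, Sym2.mem_mk_left x y⟩ ?_ ?_ ?_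
      · intro he
        rcases Sym2.eq_iff.1 he with ⟨-, h1⟩ | ⟨h1, -⟩; exacts [hyh h1, hxh h1]
      · intro he
        rcases Sym2.eq_iff.1 he with ⟨h1, -⟩ | ⟨h1, -⟩; exacts [hxh h1, hsu h1]
      · intro he
        rcases Sym2.eq_iff.1 he with ⟨h1, -⟩ | ⟨h1, -⟩; exacts [hxh h1, hsv h1]
    · exact absurd rfl hxh
  · -- the edge block `{s, h}` rooted at `s`
    intro x y z hx hy hz
    have h3 := IncStarCycle.sahiE_principal_edge_nonneg w' s h 3 ![{x}, {y}, {z}]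
      (fun i => by fin_cases i <;> simpa)
    have hf : (fun i : Fin 3 => ind (⋂ t ∈ (![{x}, {y}, {z}] : Fin 3 → Finset V) i,
        (openConnIn ({s, h} : Set V) s t : Set (BondConfig V)))) =
        ![ind (openConnIn ({s, h} : Set V) s x), ind (openConnIn ({s, h} : Set V) s y),
          ind (openConnIn ({s, h} : Set V) s z)] := by
      funext i; fin_cases i <;> simp
    rw [hf, sahiE_three_ind] at h3
    exact h3
  · intro x y z hx hy hz
    exact H w' hoff hzero x y z hx hy hz

end SahiRootSide

end Summit.CriticalPhenomena.PercolationContinuityZ3.Theorems
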